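import Literature.MathematicalPhysics.QuantumFieldTheory.BalabanImbrieJaffe1984to88.BIJ88RestrictedInteractionAllOrders308
import Literature.MathematicalPhysics.QuantumFieldTheory.BalabanImbrieJaffe1984to88.BIJ88LogZt308
import Literature.MathematicalPhysics.QuantumFieldTheory.BalabanImbrieJaffe1984to88.BIJ88Perturbative341
import Mathlib.Probability.Moments.MGFAnalytic

/-!
# `BalabanImbrieJaffe1984to88.BIJ88GaussianMoments308` — T. Bałaban, J. Imbrie, A. Jaffe, *Effective action and cluster properties of
the abelian Higgs model*, Commun. Math. Phys. **114** (1988) 257–315 [BalabanImbrieJaffe1988]: Sect. 5.14, p. 308 [PDF 52], verbatim: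
*"Thus the restrictions and the interactions disappear at t = 0, at which point we have a purely Gaussian expectation. Thus we define
perturbative terms for the action, 𝒫_{k+1} = Σ_{α=1}^{n̄} −(1/α!)(dᵅ/dtᵅ) log z_t|_{t=0}"* (5.14.1) — the LIMITS `t → 0⁺` of all
t-derivatives of `z(t) = ∫ χ′_{Λ,t}·e^{−tW} dP` and of `log z(t)`, both interpolations at once.

statement-level skeleton of published theorems with citation tags; proofs where landed; nothing here is a claim about the Yang–Mills mass gap

ERRATUM (v1.1, docstring only; referee ref-1 gen 27/28, render `lit-balaban-r16/renders/cmp114/original-p052-x2.png`): print's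
(5.14.1) carries a leading MINUS — 𝒫_{k+1}(Λ₁₂^{(k)}) = Σ_{α=1}^{n̄} −(1/α!)(dᵅ/dtᵅ) log z_t(Λ₁₂^{(k)})|_{t=0} — and so does the
remainder (5.14.2), ℛ_k(Λ₁₂^{(k)}) = ∫₀¹ dt −((1−t)^{n̄}/(n̄+1)!)⟨d/dt; …; d/dt⟩_t; the v1 quotation dropped the sign.  Declarations are
unchanged (the minus lives inside `BIJ88Perturbative341.pertPart`).

WHAT THIS FILE ADDS (sequel of `BIJ88RestrictedInteractionAllOrders308`: `z^{(n)}(t₀) = ∫ Σ_i C(n,i)(∂^i_tχ′)(−W)^{n−i}e^{−tW} dμ`).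
For a probability measure with CENTERED GAUSSIAN marginals `Φ_b` (Mathlib `HasGaussianLaw`, variances `≤ v`), positive thresholds
`c_b ≥ c₀ > 0`, `p > 1/2`, `e_k > 0`, and a measurable interaction `|W| ≤ K` (the hypothesis of `BIJ88Perturbative341`):
* §1 the `i = 0` Leibniz term tends to `∫ (−W)^m dμ` (dominated convergence) and the `i ≥ 1` terms vanish (Gaussian factor
  `t^{−i}e^{−κp(te_k)²}` of p. 309); hence **`z^{(n)}(t) → ∫ (−W)ⁿ dP = (dⁿ/dtⁿ)|₀ mgf_{−W}` for EVERY `n`**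
  (`tendsto_iteratedDeriv_integral_restrictedInteraction_zero/_mgf`): *"a purely Gaussian expectation"* — every Taylor coefficient of `z_t`
  at `0⁺` is a Gaussian moment of `−Ṽ`, the restrictions contributing nothing at any order;
* §2 `z` is `Cⁿ` on the branch and, by Faà di Bruno on both sides, **`(dᵅ/dtᵅ) log z_t → (dᵅ/dtᵅ)|₀ cgf_{−W}` for EVERY `α`**
  (`tendsto_iteratedDeriv_log_restrictedInteraction_cgf`): the perturbative terms (5.14.1) of the restricted interacting family ARE the
  cumulants of `−Ṽ` in the Gaussian (`t = 0`) measure — the Taylor coefficients of Mathlib's cumulant generating function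
  `cgf (−W) P` of `BIJ88Perturbative341` (there: `truncExp_one/_two`, (3.41)).

PDF held: `paper:balaban1988-cmp114-bij-abelian-higgs-effective-action` (journal page = PDF page + 256); p. 308 [PDF 52].

CITATION HEADER (lean-in-tree rule).  Part of the lit-balaban TYPED SKELETON (HOME `run/shared/lean/pub/lit-balaban/`), Phase 2,
seat p36 (gen 7, unit `lit-balaban-p36`); row **C2.Eq5.14.1-5.14.2** of `HOME/lit-balaban-r16/ROWS-C2-part2.md` (owner r16; typed leaves
untouched).  Theorems only; no definitions, no `Prop` facts; axioms standard.
-/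

namespace Literature.MathematicalPhysics.QuantumFieldTheory.BalabanImbrieJaffe1984to88.BIJ88GaussianMoments308

open MeasureTheory ProbabilityTheory Filter Set
open BIJ88Sect2Statements (pLog eK)
open BIJ88Sect5Statements (CutoffProfile cutoff)
open BIJ88RestrictedInteractionAllOrders308 (iteratedDeriv_restrictedInteraction iteratedDeriv_integral_restrictedInteraction
  hasDerivAt_integral_iteratedDeriv_restrictedInteraction)
open scoped Topology

/-! ## §1 As `t → 0⁺`: every Taylor coefficient of `z_t` is a Gaussian moment of `−Ṽ` -/

section Limits

variable (χ : CutoffProfile) {ι Ω : Type*} [MeasurableSpace Ω]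

/-- The `i = 0` Leibniz term: `∫ χ′_{Λ,t}·((−W)^m e^{−tW}) dμ → ∫ (−W)^m dμ` as `t → 0⁺` (dominated convergence; positive thresholds,
`p > 0`). [cite: BalabanImbrieJaffe1988, (5.14.2) p.308] -/
theorem tendsto_integral_momentTerm_zero {p : ℝ} (hp : 0 < p) (μ : Measure Ω) [IsFiniteMeasure μ] (B : Finset ι)
    {Φ : ι → Ω → ℝ} (hΦ : ∀ b ∈ B, Measurable (Φ b)) {c : ι → ℝ} (hc : ∀ b ∈ B, 0 < c b) {W : Ω → ℝ} (hW : Measurable W)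
    {K : ℝ} (hK : ∀ ω, |W ω| ≤ K) {ek : ℝ} (hek : 0 < ek) (m : ℕ) :
    Tendsto (fun t => ∫ ω, (∏ b ∈ B, cutoff χ (c b * pLog p (t * ek)) (Φ b ω)) * ((-W ω) ^ m * Real.exp (-(t * W ω))) ∂μ)
      (𝓝[>] (0 : ℝ)) (𝓝 (∫ ω, (-W ω) ^ m ∂μ)) := by
  refine tendsto_integral_filter_of_dominated_convergence (fun _ => K ^ m * Real.exp (max K 0)) ?_ ?_ (integrable_const _) ?_
  · exact Filter.Eventually.of_forall fun t =>
      ((BIJ88InterpolatedRestrictions308.measurable_prod_cutoff_t χ p B hΦ c ek t).mul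
        ((hW.neg.pow_const _).mul (Real.measurable_exp.comp (hW.const_mul t).neg))).aestronglyMeasurable
  · filter_upwards [BIJ88RestrictedInteraction308.eventually_branch ek] with t ht
    refine Filter.Eventually.of_forall fun ω => ?_
    have hP1 := BIJ88InterpolatedRestrictions308.abs_prod_cutoff_t_le_one χ p B (fun b => Φ b ω) c ek t
    have hE := BIJ88RestrictedInteraction308.exp_neg_mul_le_exp_max (hK ω) ht.1.le ht.2.1
    have hWm : |(-W ω) ^ m| ≤ K ^ m := by rw [abs_pow, abs_neg]; exact pow_le_pow_left₀ (abs_nonneg _) (hK ω) _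
    rw [Real.norm_eq_abs, abs_mul, abs_mul, Real.abs_exp, ← one_mul (K ^ m * Real.exp (max K 0))]
    exact mul_le_mul hP1 (mul_le_mul hWm hE (Real.exp_pos _).le (pow_nonneg ((abs_nonneg _).trans (hK ω)) _))
      (mul_nonneg (abs_nonneg _) (Real.exp_pos _).le) zero_le_one
  · refine Filter.Eventually.of_forall fun ω => ?_
    have hP := tendsto_finsetProd B (f := fun b t => cutoff χ (c b * pLog p (t * ek)) (Φ b ω)) (a := fun _ => (1 : ℝ))
      (x := 𝓝[>] (0 : ℝ)) fun b hb => BIJ88RestrictionsVanish308.tendsto_cutoff_t_one χ (hc b hb) hp hek (Φ b ω)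
    have hE : Tendsto (fun t : ℝ => (-W ω) ^ m * Real.exp (-(t * W ω))) (𝓝[>] (0 : ℝ)) (𝓝 ((-W ω) ^ m * 1)) := by
      have h : Tendsto (fun t : ℝ => Real.exp (-(t * W ω))) (𝓝 0) (𝓝 (Real.exp (-(0 * W ω)))) :=
        (Real.continuous_exp.comp (continuous_id.mul continuous_const).neg).continuousAt.tendsto
      rw [zero_mul, neg_zero, Real.exp_zero] at h
      exact (h.mono_left nhdsWithin_le_nhds).const_mul _
    simpa using hP.mul hE

/-- The `i ≥ 1` Leibniz terms vanish: with CENTERED GAUSSIAN marginals (variances `≤ v`), thresholds `|c_b| ≥ c₀ > 0`, `p > 1/2`,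
`|W| ≤ K`, for `1 ≤ i`: `∫ (∂^i_tχ′_{Λ,t})·((−W)^m e^{−tW}) dP → 0` as `t → 0⁺`. [cite: BalabanImbrieJaffe1988, p.309 (Sect. 5.14)] -/
theorem tendsto_integral_mixedTerm_zero {p : ℝ} (hp : 1 / 2 < p) (P : Measure Ω) [IsProbabilityMeasure P] (B : Finset ι)
    {Φ : ι → Ω → ℝ} (hG : ∀ b ∈ B, HasGaussianLaw (Φ b) P) (hΦ : ∀ b ∈ B, Measurable (Φ b)) (h0 : ∀ b ∈ B, P[Φ b] = 0)
    {v : ℝ} (hv : 0 < v) (hvar : ∀ b ∈ B, Var[Φ b; P] ≤ v) {c : ι → ℝ} {c₀ : ℝ} (hc₀ : 0 < c₀) (hcb : ∀ b ∈ B, c₀ ≤ |c b|)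
    (W : Ω → ℝ) {K : ℝ} (hK : ∀ ω, |W ω| ≤ K) {ek : ℝ} (hek : 0 < ek) {i : ℕ} (hi : 1 ≤ i) (m : ℕ) :
    Tendsto (fun t => ∫ ω, iteratedDeriv i (fun s => ∏ b ∈ B, cutoff χ (c b * pLog p (s * ek)) (Φ b ω)) t *
      ((-W ω) ^ m * Real.exp (-(t * W ω))) ∂P) (𝓝[>] (0 : ℝ)) (𝓝 0) := by
  obtain ⟨C, hC1, hC⟩ :=
    BIJ88GaussIntegration309Law.integral_abs_iteratedDeriv_prod_cutoff_t_le_of_hasGaussianLaw (ι := ι) (Ω := Ω) χ p i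
  obtain ⟨C', -, hC'⟩ := BIJ88GaussIntegration309Product.abs_iteratedDeriv_prod_cutoff_t_le (ι := ι) χ p i
  have hκ : 0 < 81 / 200 * (c₀ ^ 2 / v) := by positivity
  have hcne : ∀ b ∈ B, c b ≠ 0 := fun b hb h => by have := hcb b hb; rw [h, abs_zero] at this; linarith
  set E : ℝ := |K| ^ m * Real.exp (max K 0) with hEdef
  have hE0 : 0 ≤ E := by positivity
  refine squeeze_zero_norm' (a := fun t => E * ((B.card : ℝ) * C) ^ i * (2 * B.card) *
      (t ^ (-(i : ℤ)) * Real.exp (-(81 / 200 * (c₀ ^ 2 / v) * pLog p (t * ek) ^ 2)))) ?_ ?_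
  · filter_upwards [BIJ88RestrictedInteraction308.eventually_branch ek] with t ht
    have ht0 := ht.1
    have hlt1 : t * ek < 1 := ht.2.2.trans (by rw [← Real.exp_zero]; exact Real.exp_lt_exp.mpr (by norm_num))
    have hI := hC P B Φ c c₀ v hG hΦ h0 hv hvar hc₀ hcb hek ht0 ht.2.2.le i hi le_rfl
    have hwt : ∀ ω, |(-W ω) ^ m * Real.exp (-(t * W ω))| ≤ E := fun ω => by
      rw [abs_mul, Real.abs_exp, hEdef]
      have hWm : |(-W ω) ^ m| ≤ |K| ^ m := by
        rw [abs_pow, abs_neg]; exact pow_le_pow_left₀ (abs_nonneg _) ((hK ω).trans (le_abs_self K)) _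
      exact mul_le_mul hWm (BIJ88RestrictedInteraction308.exp_neg_mul_le_exp_max (hK ω) ht0.le ht.2.1) (Real.exp_pos _).le
        (pow_nonneg (abs_nonneg _) _)
    have hmeasD := BIJ88RestrictionsAllOrders308.measurable_iteratedDeriv_prod_cutoff_t χ p B hΦ c hek i ht0 hlt1
    have hpt : ∀ ω, |iteratedDeriv i (fun s => ∏ b ∈ B, cutoff χ (c b * pLog p (s * ek)) (Φ b ω)) t *
        ((-W ω) ^ m * Real.exp (-(t * W ω)))| ≤
        E * |iteratedDeriv i (fun s => ∏ b ∈ B, cutoff χ (c b * pLog p (s * ek)) (Φ b ω)) t| := fun ω => by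
      rw [abs_mul, mul_comm]
      exact mul_le_mul_of_nonneg_right (hwt ω) (abs_nonneg _)
    have hDint : Integrable (fun ω => |iteratedDeriv i (fun s => ∏ b ∈ B, cutoff χ (c b * pLog p (s * ek)) (Φ b ω)) t|) P := by
      refine (integrable_const (((B.card : ℝ) * C') ^ i * t ^ (-(i : ℤ)))).mono' hmeasD.abs.aestronglyMeasurable ?_
      refine Filter.Eventually.of_forall fun ω => ?_
      rw [Real.norm_eq_abs, abs_abs]
      exact hC' B (fun b => Φ b ω) c hcne hek ht0 ht.2.2.le i le_rfl
    rw [Real.norm_eq_abs]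
    calc |∫ ω, iteratedDeriv i (fun s => ∏ b ∈ B, cutoff χ (c b * pLog p (s * ek)) (Φ b ω)) t *
            ((-W ω) ^ m * Real.exp (-(t * W ω))) ∂P|
        ≤ ∫ ω, |iteratedDeriv i (fun s => ∏ b ∈ B, cutoff χ (c b * pLog p (s * ek)) (Φ b ω)) t *
            ((-W ω) ^ m * Real.exp (-(t * W ω)))| ∂P := abs_integral_le_integral_abs
      _ ≤ ∫ ω, E * |iteratedDeriv i (fun s => ∏ b ∈ B, cutoff χ (c b * pLog p (s * ek)) (Φ b ω)) t| ∂P :=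
          integral_mono_of_nonneg (Filter.Eventually.of_forall fun ω => abs_nonneg _) (hDint.const_mul _)
            (Filter.Eventually.of_forall fun ω => hpt ω)
      _ = E * ∫ ω, |iteratedDeriv i (fun s => ∏ b ∈ B, cutoff χ (c b * pLog p (s * ek)) (Φ b ω)) t| ∂P := integral_const_mul _ _
      _ ≤ E * (((B.card : ℝ) * C) ^ i * t ^ (-(i : ℤ)) * (2 * B.card * Real.exp (-(81 / 200 * (c₀ ^ 2 / v) * pLog p (t * ek) ^ 2)))) :=
          mul_le_mul_of_nonneg_left hI hE0
      _ = E * ((B.card : ℝ) * C) ^ i * (2 * B.card) *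
            (t ^ (-(i : ℤ)) * Real.exp (-(81 / 200 * (c₀ ^ 2 / v) * pLog p (t * ek) ^ 2))) := by ring
  · have h := (BIJ88RestrictionsAllOrders308.tendsto_zpow_mul_exp_neg_pLog_sq hκ hp hek i).const_mul
      (E * ((B.card : ℝ) * C) ^ i * (2 * B.card))
    rw [mul_zero] at h
    exact h

/-- **Every Taylor coefficient of `z_t` at `t = 0⁺` is a Gaussian moment of `−Ṽ`.**  For a probability measure with CENTERED GAUSSIAN
marginals `Φ_b` (Mathlib `HasGaussianLaw`, variances `≤ v`), positive thresholds `c_b ≥ c₀ > 0`, `p > 1/2`, `e_k > 0`, a measurable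
interaction `|W| ≤ K`, and every `n`: `z^{(n)}(t) → ∫ (−W)ⁿ dP` as `t → 0⁺` — *"at which point we have a purely Gaussian expectation"*;
the restrictions contribute nothing at any order. [cite: BalabanImbrieJaffe1988, (5.14.2) p.308] -/
theorem tendsto_iteratedDeriv_integral_restrictedInteraction_zero {p : ℝ} (hp : 1 / 2 < p) (P : Measure Ω) [IsProbabilityMeasure P]
    (B : Finset ι) {Φ : ι → Ω → ℝ} (hG : ∀ b ∈ B, HasGaussianLaw (Φ b) P) (hΦ : ∀ b ∈ B, Measurable (Φ b))
    (h0 : ∀ b ∈ B, P[Φ b] = 0) {v : ℝ} (hv : 0 < v) (hvar : ∀ b ∈ B, Var[Φ b; P] ≤ v) {c : ι → ℝ} {c₀ : ℝ} (hc₀ : 0 < c₀)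
    (hcb : ∀ b ∈ B, c₀ ≤ c b) {W : Ω → ℝ} (hW : Measurable W) {K : ℝ} (hK : ∀ ω, |W ω| ≤ K) {ek : ℝ} (hek : 0 < ek) (n : ℕ) :
    Tendsto (fun t => iteratedDeriv n
        (fun t => ∫ ω, (∏ b ∈ B, cutoff χ (c b * pLog p (t * ek)) (Φ b ω)) * Real.exp (-(t * W ω)) ∂P) t)
      (𝓝[>] (0 : ℝ)) (𝓝 (∫ ω, (-W ω) ^ n ∂P)) := by
  have hp0 : 0 < p := by linarith
  have hcpos : ∀ b ∈ B, 0 < c b := fun b hb => hc₀.trans_le (hcb b hb)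
  have hcne : ∀ b ∈ B, c b ≠ 0 := fun b hb => (hcpos b hb).ne'
  have hcabs : ∀ b ∈ B, c₀ ≤ |c b| := fun b hb => (hcb b hb).trans (le_abs_self _)
  -- the limit of the Leibniz sum: only i = 0 survives
  have hsum : Tendsto (fun t => ∑ i ∈ Finset.range (n + 1), (n.choose i : ℝ) *
      ∫ ω, iteratedDeriv i (fun s => ∏ b ∈ B, cutoff χ (c b * pLog p (s * ek)) (Φ b ω)) t *
        ((-W ω) ^ (n - i) * Real.exp (-(t * W ω))) ∂P) (𝓝[>] (0 : ℝ))
      (𝓝 (∑ i ∈ Finset.range (n + 1), if i = 0 then ∫ ω, (-W ω) ^ n ∂P else 0)) := by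
    refine tendsto_finsetSum _ fun i hi => ?_
    rcases Nat.eq_zero_or_pos i with h | h
    · subst h
      simp only [Nat.choose_zero_right, Nat.cast_one, one_mul, iteratedDeriv_zero, Nat.sub_zero, if_true]
      exact tendsto_integral_momentTerm_zero χ hp0 P B hΦ hcpos hW hK hek n
    · rw [if_neg h.ne']
      have h := (tendsto_integral_mixedTerm_zero χ hp P B hG hΦ h0 hv hvar hc₀ hcabs W hK hek h (n - i)).const_mul
        (n.choose i : ℝ)
      rw [mul_zero] at h
      exact h
  rw [Finset.sum_ite_eq' (Finset.range (n + 1)) 0, if_pos (Finset.mem_range.mpr (Nat.succ_pos n))] at hsum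
  refine hsum.congr' ?_
  filter_upwards [BIJ88RestrictedInteraction308.eventually_branch ek] with t ht
  have hlt1 : t * ek < 1 := ht.2.2.trans (by rw [← Real.exp_zero]; exact Real.exp_lt_exp.mpr (by norm_num))
  rw [iteratedDeriv_integral_restrictedInteraction χ p P B hΦ hcne hW hK hek n ht.1 ht.2.2]
  -- integrate the Leibniz sum term by term
  have hint : ∀ i ∈ Finset.range (n + 1), Integrable (fun ω => (n.choose i : ℝ) *
      iteratedDeriv i (fun s => ∏ b ∈ B, cutoff χ (c b * pLog p (s * ek)) (Φ b ω)) t *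
        ((-W ω) ^ (n - i) * Real.exp (-(t * W ω)))) P := by
    intro i hi
    obtain ⟨C', -, hC'⟩ := BIJ88GaussIntegration309Product.abs_iteratedDeriv_prod_cutoff_t_le (ι := ι) χ p i
    have hm := ((BIJ88RestrictionsAllOrders308.measurable_iteratedDeriv_prod_cutoff_t χ p B hΦ c hek i ht.1 hlt1).const_mul
      (n.choose i : ℝ)).mul ((hW.neg.pow_const (n - i)).mul (Real.measurable_exp.comp (hW.const_mul t).neg))
    refine (integrable_const ((n.choose i : ℝ) * (((B.card : ℝ) * C') ^ i * t ^ (-(i : ℤ))) *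
      (K ^ (n - i) * Real.exp (max K 0)))).mono' hm.aestronglyMeasurable (Filter.Eventually.of_forall fun ω => ?_)
    have hD := hC' B (fun b => Φ b ω) c hcne hek ht.1 ht.2.2.le i le_rfl
    have hWm : |(-W ω) ^ (n - i)| ≤ K ^ (n - i) := by
      rw [abs_pow, abs_neg]; exact pow_le_pow_left₀ (abs_nonneg _) (hK ω) _
    have hE := BIJ88RestrictedInteraction308.exp_neg_mul_le_exp_max (hK ω) ht.1.le ht.2.1
    rw [Real.norm_eq_abs, abs_mul, abs_mul, abs_mul, Nat.abs_cast, Real.abs_exp]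
    refine mul_le_mul (mul_le_mul_of_nonneg_left hD (Nat.cast_nonneg _)) (mul_le_mul hWm hE (Real.exp_pos _).le
      (pow_nonneg ((abs_nonneg _).trans (hK ω)) _)) (mul_nonneg (abs_nonneg _) (Real.exp_pos _).le) ?_
    exact mul_nonneg (Nat.cast_nonneg _) ((abs_nonneg _).trans hD)
  have hleib : (∫ ω, iteratedDeriv n
      (fun s => (∏ b ∈ B, cutoff χ (c b * pLog p (s * ek)) (Φ b ω)) * Real.exp (-(s * W ω))) t ∂P) =
      ∫ ω, ∑ i ∈ Finset.range (n + 1), (n.choose i : ℝ) *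
        iteratedDeriv i (fun s => ∏ b ∈ B, cutoff χ (c b * pLog p (s * ek)) (Φ b ω)) t *
          ((-W ω) ^ (n - i) * Real.exp (-(t * W ω))) ∂P :=
    integral_congr_ae (Filter.Eventually.of_forall fun ω =>
      iteratedDeriv_restrictedInteraction χ p B (fun b => Φ b ω) c (W ω) hek ht.1 hlt1 n)
  rw [hleib, integral_finsetSum _ hint]
  refine Finset.sum_congr rfl fun i _ => ?_
  rw [← integral_const_mul]
  refine integral_congr_ae (Filter.Eventually.of_forall fun ω => ?_)
  ring

/-- … equivalently `z^{(n)}(t) → (dⁿ/dtⁿ)|_{t=0} mgf_{−W}(t)`: `z_t` osculates Mathlib's moment generating function of `−W`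
(`BIJ88Perturbative341.zt_eq_mgf`: the interaction family without restrictions) to ALL orders at `t = 0⁺`.
[cite: BalabanImbrieJaffe1988, (5.14.1) p.308] -/
theorem tendsto_iteratedDeriv_integral_restrictedInteraction_mgf {p : ℝ} (hp : 1 / 2 < p) (P : Measure Ω) [IsProbabilityMeasure P]
    (B : Finset ι) {Φ : ι → Ω → ℝ} (hG : ∀ b ∈ B, HasGaussianLaw (Φ b) P) (hΦ : ∀ b ∈ B, Measurable (Φ b))
    (h0 : ∀ b ∈ B, P[Φ b] = 0) {v : ℝ} (hv : 0 < v) (hvar : ∀ b ∈ B, Var[Φ b; P] ≤ v) {c : ι → ℝ} {c₀ : ℝ} (hc₀ : 0 < c₀)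
    (hcb : ∀ b ∈ B, c₀ ≤ c b) {W : Ω → ℝ} (hW : Measurable W) {K : ℝ} (hK : ∀ ω, |W ω| ≤ K) {ek : ℝ} (hek : 0 < ek) (n : ℕ) :
    Tendsto (fun t => iteratedDeriv n
        (fun t => ∫ ω, (∏ b ∈ B, cutoff χ (c b * pLog p (t * ek)) (Φ b ω)) * Real.exp (-(t * W ω)) ∂P) t)
      (𝓝[>] (0 : ℝ)) (𝓝 (iteratedDeriv n (mgf (fun ω => -W ω) P) 0)) := by
  have hint : (0 : ℝ) ∈ interior (integrableExpSet (fun ω => -W ω) P) :=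
    BIJ88Perturbative341.mem_interior_integrableExpSet hW.aestronglyMeasurable (Filter.Eventually.of_forall hK) 0
  rw [iteratedDeriv_mgf_zero hint n]
  have h := tendsto_iteratedDeriv_integral_restrictedInteraction_zero χ hp P B hG hΦ h0 hv hvar hc₀ hcb hW hK hek n
  simpa only [Pi.pow_apply] using h

end Limits

/-! ## §2 `(dᵅ/dtᵅ) log z_t → (dᵅ/dtᵅ)|₀ cgf_{−W}`: the perturbative terms are the Gaussian cumulants -/

section Cumulants

variable (χ : CutoffProfile) {ι Ω : Type*} [MeasurableSpace Ω]

/-- Every `t ↦ ∫ ∂^m_t[χ′_{Λ,t}e^{−tW}] dμ` is `Cⁿ` on the branch `(0, e^{−1}/e_k)`, all `n m` (induction on `n` across all `m`).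
[cite: BalabanImbrieJaffe1988, (5.14.3) p.309] -/
theorem contDiffOn_integral_iteratedDeriv_restrictedInteraction (p : ℝ) (μ : Measure Ω) [IsFiniteMeasure μ] (B : Finset ι)
    {Φ : ι → Ω → ℝ} (hΦ : ∀ b ∈ B, Measurable (Φ b)) {c : ι → ℝ} (hc : ∀ b ∈ B, c b ≠ 0) {W : Ω → ℝ} (hW : Measurable W)
    {K : ℝ} (hK : ∀ ω, |W ω| ≤ K) {ek : ℝ} (hek : 0 < ek) (n m : ℕ) :
    ContDiffOn ℝ n (fun t => ∫ ω, iteratedDeriv m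
        (fun s => (∏ b ∈ B, cutoff χ (c b * pLog p (s * ek)) (Φ b ω)) * Real.exp (-(s * W ω))) t ∂μ)
      (Set.Ioo 0 (Real.exp (-1) / ek)) := by
  have hbr : ∀ t ∈ Set.Ioo 0 (Real.exp (-1) / ek), t * ek < Real.exp (-1) := fun t ht => by
    rw [← lt_div_iff₀ hek]; exact ht.2
  have hdiff : ∀ m : ℕ, DifferentiableOn ℝ (fun t => ∫ ω, iteratedDeriv m
      (fun s => (∏ b ∈ B, cutoff χ (c b * pLog p (s * ek)) (Φ b ω)) * Real.exp (-(s * W ω))) t ∂μ)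
      (Set.Ioo 0 (Real.exp (-1) / ek)) := fun m t ht =>
    (hasDerivAt_integral_iteratedDeriv_restrictedInteraction χ p μ B hΦ hc hW hK hek ht.1 (hbr t ht)
      m).2.differentiableAt.differentiableWithinAt
  induction n generalizing m with
  | zero =>
    rw [Nat.cast_zero, contDiffOn_zero]
    exact (hdiff m).continuousOn
  | succ n ih =>
    rw [Nat.cast_succ, contDiffOn_succ_iff_deriv_of_isOpen isOpen_Ioo]
    refine ⟨hdiff m, fun h => absurd h (by exact_mod_cast WithTop.natCast_ne_top n), ?_⟩
    refine (ih (m + 1)).congr fun t ht => ?_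
    exact (hasDerivAt_integral_iteratedDeriv_restrictedInteraction χ p μ B hΦ hc hW hK hek ht.1 (hbr t ht) m).2.deriv

/-- **`z(t) = ∫ χ′_{Λ,t}e^{−tW} dμ` is `Cⁿ` at every point of the branch**, every `n`. [cite: BalabanImbrieJaffe1988, (5.14.3) p.309] -/
theorem contDiffAt_integral_restrictedInteraction (p : ℝ) (μ : Measure Ω) [IsFiniteMeasure μ] (B : Finset ι) {Φ : ι → Ω → ℝ}
    (hΦ : ∀ b ∈ B, Measurable (Φ b)) {c : ι → ℝ} (hc : ∀ b ∈ B, c b ≠ 0) {W : Ω → ℝ} (hW : Measurable W) {K : ℝ}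
    (hK : ∀ ω, |W ω| ≤ K) {ek : ℝ} (hek : 0 < ek) (n : ℕ) {t : ℝ} (ht : 0 < t) (h1 : t * ek < Real.exp (-1)) :
    ContDiffAt ℝ n (fun t => ∫ ω, (∏ b ∈ B, cutoff χ (c b * pLog p (t * ek)) (Φ b ω)) * Real.exp (-(t * W ω)) ∂μ) t := by
  have h := contDiffOn_integral_iteratedDeriv_restrictedInteraction χ p μ B hΦ hc hW hK hek n 0
  simp only [iteratedDeriv_zero] at h
  exact h.contDiffAt (isOpen_Ioo.mem_nhds ⟨ht, by rwa [lt_div_iff₀ hek]⟩)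

/-- **The Taylor coefficients of the cumulant generating function by Faà di Bruno**: for a probability measure and bounded measurable
`W`, `(dᵅ/dtᵅ)|₀ cgf_{−W} = Σ_{c : OrderedFinpartition α} log^{(|c|)}(1)·Π_j ∫ (−W)^{|c_j|} dP` (the moment–cumulant formula, Mathlib's
`cgf = log ∘ mgf`, `iteratedDeriv_mgf_zero`). [cite: BalabanImbrieJaffe1988, (5.14.1) p.308] -/
theorem iteratedDeriv_cgf_zero_eq_sum (P : Measure Ω) [IsProbabilityMeasure P] {W : Ω → ℝ} (hW : Measurable W) {K : ℝ}
    (hK : ∀ ω, |W ω| ≤ K) (α : ℕ) :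
    iteratedDeriv α (cgf (fun ω => -W ω) P) 0 =
      ∑ c' : OrderedFinpartition α, iteratedDeriv c'.length Real.log 1 * ∏ j, ∫ ω, (-W ω) ^ c'.partSize j ∂P := by
  have hint : (0 : ℝ) ∈ interior (integrableExpSet (fun ω => -W ω) P) :=
    BIJ88Perturbative341.mem_interior_integrableExpSet hW.aestronglyMeasurable (Filter.Eventually.of_forall hK) 0
  have hf : ContDiffAt ℝ (α : WithTop ℕ∞) (mgf (fun ω => -W ω) P) 0 := (analyticAt_mgf hint).contDiffAt
  have hg : ContDiffAt ℝ (α : WithTop ℕ∞) Real.log (mgf (fun ω => -W ω) P 0) :=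
    Real.contDiffAt_log.mpr (by rw [mgf_zero]; exact one_ne_zero)
  have hcomp : cgf (fun ω => -W ω) P = Real.log ∘ mgf (fun ω => -W ω) P := by funext t; rfl
  rw [hcomp, iteratedDeriv_comp_eq_sum_orderedFinpartition hg hf le_rfl, mgf_zero]
  refine Finset.sum_congr rfl fun c' _ => ?_
  congr 1
  refine Finset.prod_congr rfl fun j _ => ?_
  rw [iteratedDeriv_mgf_zero hint]
  simp only [Pi.pow_apply]

/-- **(5.14.1): the perturbative terms of the restricted interacting family are the Gaussian cumulants of `−Ṽ`.**  For a probability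
measure with CENTERED GAUSSIAN marginals `Φ_b` (Mathlib `HasGaussianLaw`, variances `≤ v`), positive thresholds `c_b ≥ c₀ > 0`,
`p > 1/2`, `e_k > 0`, a measurable interaction `|W| ≤ K`, and EVERY `α`:
`(dᵅ/dtᵅ) log z_t → (dᵅ/dtᵅ)|_{t=0} cgf_{−W}(t)` as `t → 0⁺`, `z_t = ∫ χ′_{Λ,t} e^{−tW} dP` — both *"the restrictions and the
interactions disappear at t = 0"* and the identification of `𝒫` with the Taylor coefficients of `log ∫ e^{−tW} dP`
(`BIJ88Perturbative341`). [cite: BalabanImbrieJaffe1988, (5.14.1) p.308] -/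
theorem tendsto_iteratedDeriv_log_restrictedInteraction_cgf {p : ℝ} (hp : 1 / 2 < p) (P : Measure Ω) [IsProbabilityMeasure P]
    (B : Finset ι) {Φ : ι → Ω → ℝ} (hG : ∀ b ∈ B, HasGaussianLaw (Φ b) P) (hΦ : ∀ b ∈ B, Measurable (Φ b))
    (h0 : ∀ b ∈ B, P[Φ b] = 0) {v : ℝ} (hv : 0 < v) (hvar : ∀ b ∈ B, Var[Φ b; P] ≤ v) {c : ι → ℝ} {c₀ : ℝ} (hc₀ : 0 < c₀)
    (hcb : ∀ b ∈ B, c₀ ≤ c b) {W : Ω → ℝ} (hW : Measurable W) {K : ℝ} (hK : ∀ ω, |W ω| ≤ K) {ek : ℝ} (hek : 0 < ek) (α : ℕ) :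
    Tendsto (fun t => iteratedDeriv α (fun t => Real.log
        (∫ ω, (∏ b ∈ B, cutoff χ (c b * pLog p (t * ek)) (Φ b ω)) * Real.exp (-(t * W ω)) ∂P)) t)
      (𝓝[>] (0 : ℝ)) (𝓝 (iteratedDeriv α (cgf (fun ω => -W ω) P) 0)) := by
  have hp0 : 0 < p := by linarith
  have hcpos : ∀ b ∈ B, 0 < c b := fun b hb => hc₀.trans_le (hcb b hb)
  have hcne : ∀ b ∈ B, c b ≠ 0 := fun b hb => (hcpos b hb).ne'
  set z : ℝ → ℝ := fun t => ∫ ω, (∏ b ∈ B, cutoff χ (c b * pLog p (t * ek)) (Φ b ω)) * Real.exp (-(t * W ω)) ∂P with hzdef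
  have hz1 : Tendsto z (𝓝[>] (0 : ℝ)) (𝓝 1) := by
    have h := BIJ88RestrictedInteraction308.tendsto_integral_restrictedInteraction_zero χ hp0 P B hΦ hcpos hW hK hek
    rwa [probReal_univ] at h
  have hzne : ∀ᶠ t in 𝓝[>] (0 : ℝ), z t ≠ 0 :=
    (hz1.eventually (lt_mem_nhds (by norm_num : (1 : ℝ) / 2 < 1))).mono fun t ht h => by rw [h] at ht; linarith
  -- every Faà di Bruno term converges
  have hterm : ∀ c' : OrderedFinpartition α,
      Tendsto (fun t => iteratedDeriv c'.length Real.log (z t) * ∏ j, iteratedDeriv (c'.partSize j) z t) (𝓝[>] (0 : ℝ))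
        (𝓝 (iteratedDeriv c'.length Real.log 1 * ∏ j, ∫ ω, (-W ω) ^ c'.partSize j ∂P)) := by
    intro c'
    refine ((BIJ88LogZt308.continuousAt_iteratedDeriv_log_one c'.length).tendsto.comp hz1).mul ?_
    exact tendsto_finsetProd _ fun j _ =>
      tendsto_iteratedDeriv_integral_restrictedInteraction_zero χ hp P B hG hΦ h0 hv hvar hc₀ hcb hW hK hek (c'.partSize j)
  have hsum := tendsto_finsetSum (Finset.univ : Finset (OrderedFinpartition α)) fun c' _ => hterm c'
  rw [← iteratedDeriv_cgf_zero_eq_sum P hW hK α] at hsum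
  refine hsum.congr' ?_
  filter_upwards [hzne, BIJ88RestrictedInteraction308.eventually_branch ek] with t hzt ht
  have hf := contDiffAt_integral_restrictedInteraction χ p P B hΦ hcne hW hK hek α ht.1 ht.2.2
  have hg : ContDiffAt ℝ (α : WithTop ℕ∞) Real.log (z t) := Real.contDiffAt_log.mpr hzt
  exact (iteratedDeriv_comp_eq_sum_orderedFinpartition (g := Real.log) hg hf le_rfl).symm

/-- **(5.14.1) ASSEMBLED, both interpolations**: the truncated perturbative part with the restrictions included,
`Σ_{α=1}^{n̄} −(1/α!)(dᵅ/dtᵅ) log z_t` (sign convention of `BIJ88Perturbative341.pertPart`, (3.41)), evaluated along `t → 0⁺`, tends to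
`pertPart n̄ (cgf_{−W})` — the perturbative part of the pure interaction family `∫ e^{−tW} dP` of `BIJ88Perturbative341`.
[cite: BalabanImbrieJaffe1988, (5.14.1) p.308] -/
theorem tendsto_pertPart_restrictedInteraction {p : ℝ} (hp : 1 / 2 < p) (P : Measure Ω) [IsProbabilityMeasure P]
    (B : Finset ι) {Φ : ι → Ω → ℝ} (hG : ∀ b ∈ B, HasGaussianLaw (Φ b) P) (hΦ : ∀ b ∈ B, Measurable (Φ b))
    (h0 : ∀ b ∈ B, P[Φ b] = 0) {v : ℝ} (hv : 0 < v) (hvar : ∀ b ∈ B, Var[Φ b; P] ≤ v) {c : ι → ℝ} {c₀ : ℝ} (hc₀ : 0 < c₀)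
    (hcb : ∀ b ∈ B, c₀ ≤ c b) {W : Ω → ℝ} (hW : Measurable W) {K : ℝ} (hK : ∀ ω, |W ω| ≤ K) {ek : ℝ} (hek : 0 < ek) (nbar : ℕ) :
    Tendsto (fun t => ∑ α ∈ Finset.range nbar, -((1 / ((α + 1).factorial : ℝ)) * iteratedDeriv (α + 1) (fun t => Real.log
        (∫ ω, (∏ b ∈ B, cutoff χ (c b * pLog p (t * ek)) (Φ b ω)) * Real.exp (-(t * W ω)) ∂P)) t))
      (𝓝[>] (0 : ℝ)) (𝓝 (BIJ88Perturbative341.pertPart nbar (cgf (fun ω => -W ω) P))) := by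
  rw [BIJ88Perturbative341.pertPart_def]
  refine tendsto_finsetSum _ fun α _ => ?_
  exact ((tendsto_iteratedDeriv_log_restrictedInteraction_cgf χ hp P B hG hΦ h0 hv hvar hc₀ hcb hW hK hek (α + 1)).const_mul
    _).neg

end Cumulants

end Literature.MathematicalPhysics.QuantumFieldTheory.BalabanImbrieJaffe1984to88.BIJ88GaussianMoments308
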